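import Literature.AlgebraicGeometry.Resolution.OriginLocalRing
import Mathlib.RingTheory.MvPowerSeries.Inverse
import HarnessLib

/-!
# Taylor expansion of the local ring of affine space at a rational point

Topic: `Literature/AlgebraicGeometry/Resolution`. The embedding of the algebraic local ring
`F[x₁, …, xₙ]_{(x₁, …, xₙ)}` (`originLocalRing`, `OriginLocalRing.lean`) into the formal power
series ring `F[[X₁, …, Xₙ]]` — its completion — sending `xᵢ ↦ Xᵢ`: a fraction `f(x)/g(x)` with
`g(0) ≠ 0` goes to the power series `f · g⁻¹`. This is the map "`B = k[x,y]_{(x,y)} ⊂ B̂ = k[[x,y]]`"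
in which Cutkosky (Math. Ann. 362 (2015), Lemma 3.1) writes the expansions
`u = xᵖ(c₀ + f₀ y + xΛ₀)`, `v = τ₀(y) yᵖ + e₀ x + xΩ₀`; it is infrastructure for the discharge of
`Literature.Barriers.ResolutionOfSingularities.Cutkosky.Cutkosky2014`.

## Content (all proved)

* `polyToPowerSeries F n : F[X] →ₐ[F] F[[X]]` (the coercion as an algebra map);
* `originTaylor F n : F[X]_{(X)} →ₐ[F] F[[X]]` (localisation lift: `g ∉ (X)` has invertible
  constant coefficient), `originTaylorAt hx : originLocalRing hx →ₐ[F] F[[X]]`;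
* values on coordinates / polynomials / fractions (`originTaylorAt_coord`, `originTaylorAt_aeval`,
  `originTaylorAt_div`), injectivity (`originTaylorAt_injective`), and the constant term is the
  residue: `constantCoeff (originTaylorAt hx q) = 0 ↔ q ∈ 𝔪` (`constantCoeff_originTaylorAt_eq_zero_iff`).

Everything here is [folklore] (Zariski–Samuel II, Ch. VIII §2; Matsumura §8).
-/

noncomputable section

namespace Literature.AlgebraicGeometry.Resolution

universe u v

open _root_.MvPolynomial IsLocalRing

section Polynomial

variable (F : Type u) [Field F] (n : ℕ)

/-- The coercion `F[X₁, …, Xₙ] → F[[X₁, …, Xₙ]]` as an `F`-algebra map. [folklore] -/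
def polyToPowerSeries : MvPolynomial (Fin n) F →ₐ[F] MvPowerSeries (Fin n) F :=
  { MvPolynomial.coeToMvPowerSeries.ringHom with
    commutes' := fun c => by
      change ((algebraMap F (MvPolynomial (Fin n) F) c : MvPolynomial (Fin n) F) :
        MvPowerSeries (Fin n) F) = algebraMap F (MvPowerSeries (Fin n) F) c
      rw [MvPolynomial.algebraMap_eq, MvPolynomial.coe_C, MvPowerSeries.algebraMap_apply,
        Algebra.algebraMap_self, RingHom.id_apply] }

/-- `polyToPowerSeries` is the coercion. [folklore] -/
@[simp] theorem polyToPowerSeries_apply (f : MvPolynomial (Fin n) F) :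
    polyToPowerSeries F n f = (f : MvPowerSeries (Fin n) F) := rfl

/-- The constant coefficient of a polynomial is that of its power series. [folklore] -/
theorem constantCoeff_coe (f : MvPolynomial (Fin n) F) :
    MvPowerSeries.constantCoeff (f : MvPowerSeries (Fin n) F) = constantCoeff f := by
  rw [← MvPowerSeries.coeff_zero_eq_constantCoeff_apply, MvPolynomial.coeff_coe, constantCoeff_eq]

/-- Off the ideal of the origin a polynomial is a unit of `F[[X]]`. [folklore] -/
theorem isUnit_coe_of_mem_primeCompl (g : (originIdeal F n).primeCompl) :
    IsUnit (polyToPowerSeries F n g) := by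
  rw [polyToPowerSeries_apply, MvPowerSeries.isUnit_iff_constantCoeff, constantCoeff_coe,
    isUnit_iff_ne_zero]
  exact fun h => g.2 ((mem_originIdeal_iff F n).mpr h)

/-- **Taylor expansion** `F[X]_{(X)} → F[[X]]`: the localisation lift of the coercion. [folklore] -/
def originTaylor : OriginLocalization F n →ₐ[F] MvPowerSeries (Fin n) F :=
  IsLocalization.liftAlgHom (M := (originIdeal F n).primeCompl) (f := polyToPowerSeries F n)
    (isUnit_coe_of_mem_primeCompl F n)

/-- `originTaylor` on a polynomial. [folklore] -/
theorem originTaylor_algebraMap (f : MvPolynomial (Fin n) F) :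
    originTaylor F n (algebraMap _ _ f) = (f : MvPowerSeries (Fin n) F) := by
  rw [originTaylor, IsLocalization.liftAlgHom_apply, IsLocalization.lift_eq]
  rfl

/-- `originTaylor` on a fraction `f/g`: the power series `f · g⁻¹`. [folklore] -/
theorem originTaylor_mk' (f : MvPolynomial (Fin n) F) (g : (originIdeal F n).primeCompl) :
    originTaylor F n (IsLocalization.mk' _ f g) =
      (f : MvPowerSeries (Fin n) F) * ((g : MvPolynomial (Fin n) F) : MvPowerSeries (Fin n) F)⁻¹ := by
  have hg : MvPowerSeries.constantCoeff (((g : MvPolynomial (Fin n) F)) : MvPowerSeries (Fin n) F) ≠ 0 := by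
    rw [constantCoeff_coe]
    exact fun h => g.2 ((mem_originIdeal_iff F n).mpr h)
  rw [originTaylor, IsLocalization.liftAlgHom_apply]
  refine (IsLocalization.lift_mk'_spec _ _ _ _).mpr ?_
  change (f : MvPowerSeries (Fin n) F) =
    (((g : MvPolynomial (Fin n) F)) : MvPowerSeries (Fin n) F) * (↑f * (↑(g : MvPolynomial (Fin n) F))⁻¹)
  rw [mul_left_comm, MvPowerSeries.mul_inv_cancel _ hg, mul_one]

/-- The Taylor expansion is injective. [folklore] -/
theorem originTaylor_injective : Function.Injective (originTaylor F n) := by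
  rw [originTaylor, IsLocalization.coe_liftAlgHom, IsLocalization.lift_injective_iff]
  intro a b
  rw [(IsLocalization.injective (OriginLocalization F n) (originIdeal F n).primeCompl_le_nonZeroDivisors).eq_iff]
  exact ((MvPolynomial.coe_injective (σ := Fin n) (R := F)).eq_iff (a := a) (b := b)).symm

end Polynomial

section Field

variable {F : Type u} [Field F] {n : ℕ} {L : Type v} [Field L] [Algebra F L] {x : Fin n → L}

/-- **Taylor expansion of `F[x]_{(x)} ⊆ L`** at the algebraically independent point `x`:
`F[x]_{(x)} ≅ F[X]_{(X)} → F[[X]]`. [folklore] -/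
def originTaylorAt (hx : AlgebraicIndependent F x) : originLocalRing hx →ₐ[F] MvPowerSeries (Fin n) F :=
  (originTaylor F n).comp ((originLocalRingEquiv hx).symm : originLocalRing hx →ₐ[F] OriginLocalization F n)

/-- Unfolding `originTaylorAt` through the defining equivalence. [folklore] -/
theorem originTaylorAt_equiv (hx : AlgebraicIndependent F x) (z : OriginLocalization F n) :
    originTaylorAt hx (originLocalRingEquiv hx z) = originTaylor F n z := by
  rw [originTaylorAt, AlgHom.comp_apply]
  exact congrArg _ ((originLocalRingEquiv hx).symm_apply_apply z)

/-- The Taylor expansion of `F[x]_{(x)}` is injective. [folklore] -/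
theorem originTaylorAt_injective (hx : AlgebraicIndependent F x) :
    Function.Injective (originTaylorAt hx) :=
  (originTaylor_injective F n).comp (originLocalRingEquiv hx).symm.injective

/-- On a fraction `f(x)/g(x)`, `g(0) ≠ 0`, the Taylor expansion is `f · g⁻¹`. [folklore] -/
theorem originTaylorAt_div (hx : AlgebraicIndependent F x) (f g : MvPolynomial (Fin n) F)
    (hg : constantCoeff g ≠ 0) (hmem : aeval x f / aeval x g ∈ originLocalRing hx) :
    originTaylorAt hx ⟨aeval x f / aeval x g, hmem⟩ =
      (f : MvPowerSeries (Fin n) F) * (g : MvPowerSeries (Fin n) F)⁻¹ := by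
  set g' : (originIdeal F n).primeCompl := ⟨g, fun h => hg ((mem_originIdeal_iff F n).mp h)⟩
  have he : (⟨aeval x f / aeval x g, hmem⟩ : originLocalRing hx) =
      originLocalRingEquiv hx (IsLocalization.mk' _ f g') :=
    Subtype.ext (by rw [coe_originLocalRingEquiv, originEmb_mk' hx f g'])
  rw [he, originTaylorAt_equiv, originTaylor_mk']

/-- On a polynomial `f(x)` the Taylor expansion is `f`. [folklore] -/
theorem originTaylorAt_aeval (hx : AlgebraicIndependent F x) (f : MvPolynomial (Fin n) F) :
    originTaylorAt hx ⟨aeval x f, aeval_mem_originLocalRing hx f⟩ = (f : MvPowerSeries (Fin n) F) := by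
  have he : (⟨aeval x f, aeval_mem_originLocalRing hx f⟩ : originLocalRing hx) =
      originLocalRingEquiv hx (algebraMap _ _ f) :=
    Subtype.ext (by rw [coe_originLocalRingEquiv, originEmb_algebraMap])
  rw [he, originTaylorAt_equiv, originTaylor_algebraMap]

/-- The Taylor expansion sends the coordinate `xᵢ` to the variable `Xᵢ`. [folklore] -/
theorem originTaylorAt_coord (hx : AlgebraicIndependent F x) (i : Fin n) :
    originTaylorAt hx (originCoord hx i) = MvPowerSeries.X i := by
  rw [← originLocalRingEquiv_X, originTaylorAt_equiv, originTaylor_algebraMap, MvPolynomial.coe_X]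

/-- Any element of `F[x]_{(x)}` with a chosen fraction representation. [folklore] -/
theorem originTaylorAt_eq_of_eq_div (hx : AlgebraicIndependent F x) (q : originLocalRing hx)
    (f g : MvPolynomial (Fin n) F) (hg : constantCoeff g ≠ 0) (hq : (q : L) = aeval x f / aeval x g) :
    originTaylorAt hx q = (f : MvPowerSeries (Fin n) F) * (g : MvPowerSeries (Fin n) F)⁻¹ := by
  have : q = ⟨aeval x f / aeval x g, hq ▸ q.2⟩ := Subtype.ext hq
  rw [this, originTaylorAt_div hx f g hg]

/-- **The constant term of the Taylor expansion detects the maximal ideal**: for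
`q ∈ F[x]_{(x)}`, `q ∈ 𝔪` iff the constant coefficient of its expansion vanishes. [folklore] -/
theorem constantCoeff_originTaylorAt_eq_zero_iff (hx : AlgebraicIndependent F x)
    (q : originLocalRing hx) :
    MvPowerSeries.constantCoeff (originTaylorAt hx q) = 0 ↔
      (haveI := isLocalRing_originLocalRing hx; q ∈ maximalIdeal (originLocalRing hx)) := by
  obtain ⟨f, g, hg, hq⟩ := (mem_originLocalRing_iff hx).mp q.2
  have hq' : q = ⟨aeval x f / aeval x g, hq ▸ q.2⟩ := Subtype.ext hq
  rw [originTaylorAt_eq_of_eq_div hx q f g hg hq, map_mul, MvPowerSeries.constantCoeff_inv,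
    constantCoeff_coe, constantCoeff_coe, mul_eq_zero, inv_eq_zero, or_iff_left hg, hq',
    div_mem_maximalIdeal_originLocalRing_iff hx f g hg]

/-- Units of `F[x]_{(x)}` expand to power series with nonzero constant term. [folklore] -/
theorem constantCoeff_originTaylorAt_ne_zero_iff (hx : AlgebraicIndependent F x)
    (q : originLocalRing hx) :
    MvPowerSeries.constantCoeff (originTaylorAt hx q) ≠ 0 ↔ IsUnit q := by
  haveI := isLocalRing_originLocalRing hx
  rw [Ne, constantCoeff_originTaylorAt_eq_zero_iff, IsLocalRing.mem_maximalIdeal, mem_nonunits_iff,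
    not_not]

end Field

end Literature.AlgebraicGeometry.Resolution

end
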